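import Summits.Parity.GeneralizedHardyLittlewood.Theorems.PrimeLevelFamEdgeMomentsBeyondDiagonalDiagRemFourFourInnerSelberg
import Summits.Parity.GeneralizedHardyLittlewood.Theorems.PrimeLevelFamEdgeMomentsBeyondDiagonalDiagRemTwoFourEstimate
import HarnessLib

/-!
# Route `PrimeLevelFamEdge`, crux K_A `MomentsBeyondDiagonal` (stmt-Parity-20007), line «petersson_layers» v4, stub `stub_diag`:
# **THE REMAINDER ESTIMATE (R₄₄) OF ORDER `(4,4)`, PROVED** (brick B5 — assembly; the last input of rung `N = 4`)

Last brick of (R₄₄): the hypothesis `hR` of `…DiagOrderFourFourOfR44.orderFourFour_target_of_remainder` (lineage famedge-1 g16,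
(Poly₄₄) discharged there) at `Δ = 3/2`, literally. Assembly exactly as for the orders `(3,3)` / `(2,4)`
(`…DiagRemThreeThreeEstimate`, `…DiagRemTwoFourEstimate`): the generic rewriting
`…DiagRemFourFourInnerSelberg.selbergRem_inner_eq_weight` puts each `(c,g)` term in the coordinates of
`…DiagRemFourFourInnerSelberg.abs_inner_rem_selberg_le₄₄` (a factor `W(cg)²`; no restatement of the 24-kB weight is needed),
`…DiagRemOuterPow.per_term_bound_gen_pow 16` (weight `D²`, envelope `Λ²⁰`, threshold `K₁ = ⌊q̂^{1/4}⌋`) and the `Σ_cΣ_g`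
bookkeeping + `final_arith_pow (e := 20) (A := 16) (b := 5)` close it:
`Λ²⁰·(power saving) + Λ²⁰·3Z₂²(2+log N)·4¹⁶/log¹⁶q̂ ≪ log⁵ q̂` (budget of order `(4,4)`: main `log⁸`, error `log⁵`).

* `remainder_estimate₄₄` — **(R₄₄): for every admissible `P` and every `Δ' ∈ (1, 3/2]` there are `C, q₀` with
  `|Sel_rem₄₄(q)| ≤ C·log⁵ q̂` for `q ≥ q₀`** — literally the hypothesis `hR` of `orderFourFour_target_of_remainder` (`Δ = 3/2`).

With `…DiagOrderFourFourOfR44` this makes the order-`(4,4)` piece of `stub_diag` unconditional on the window `(1, 3/2]`, and with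
`…DiagRungFourOfTarget44` rung `N = 4` (corollaries filed separately). Def-free; theorems only. Helper `--supports stmt-Parity-20007`;
closes nothing (`stub_diag` needs every rung; `stub_rung/core/band/farP` remain); K_A, K_B and the Parity summit are NOT proved;
nothing about Landau–Siegel zeros.

## References
* E. Kowalski, P. Michel, J. VanderKam, J. reine angew. Math. 526 (2000), (22)–(28) pp. 12–15 and Prop. 5.1 p. 18.
  [cite: KowalskiMichelVanderKam2000, (23)–(28) and Prop. 5.1 — derivation (order-(4,4) piece of the diagonal, general Q)]
-/

noncomputable section

open scoped Real ArithmeticFunction.Moebius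
open Finset ArithmeticFunction Polynomial Real MeasureTheory
open Set (Ioi)

namespace Summit.Parity.GeneralizedHardyLittlewood.Theorems.MomentsBeyondDiagonal.DiagCorner

open Literature.NumberTheory.LFunctions Literature.NumberTheory.LFunctions.KMV2000
open MollifierMainTerm (W)
open Literature.Barriers.Parity (Icc_one_eq_Ioc_zero)
open Summit.Parity.GeneralizedHardyLittlewood.Theorems.BeyondDiagonalBeatsQuarter.KernelFormXSq
  (copTauW copTauW_apply divWeight divWeight_nonneg one_le_divWeight abs_W_le)
open Summit.Parity.GeneralizedHardyLittlewood.Theorems.BeyondDiagonalBeatsQuarter.Corner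
open Summit.Parity.GeneralizedHardyLittlewood.Theorems.MomentsBeyondDiagonal.DiagKernel (coeff_zero_one_of_admissible)

/-! ### (R₄₄) -/

set_option maxHeartbeats 12000000 in
set_option maxRecDepth 20000 in
-- large statement (verbatim `hR` of `orderFourFour_target_of_remainder`) and assembly
/-- **THE REMAINDER ESTIMATE (R₄₄) OF ORDER `(4,4)`** (window `(1, 3/2]`): the hypothesis `hR` of
`…DiagOrderFourFourOfR44.orderFourFour_target_of_remainder` (`Δ = 3/2`), proved.
[cite: KowalskiMichelVanderKam2000, (23)–(28) and Prop. 5.1 — derivation (order-(4,4) piece of the diagonal, general Q)] -/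
theorem remainder_estimate₄₄ :
    ∃ E₀₀ E₀₁ E₀₂ E₀₃ E₀₄ E₁₀ E₁₁ E₁₂ E₁₃ E₁₄ E₂₀ E₂₁ E₂₂ E₂₃ E₂₄ E₃₀ E₃₁ E₃₂ E₃₃ E₃₄ E₄₀ E₄₁ E₄₂ E₄₃ E₄₄ μ₂ μ₄ μ₆ μ₈ : ℝ, ∀ P : ℝ[X], KMV2000.Admissible P → ∀ Δ' : ℝ, 1 < Δ' → Δ' ≤ 3 / 2 →
      ∃ C : ℝ, ∃ q₀ : ℕ, ∀ (q : ℕ) [NeZero q], q₀ ≤ q →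
        |∑ c ∈ Icc 1 ⌊qhat q ^ Δ'⌋₊, ∑ g ∈ Icc 1 (⌊qhat q ^ Δ'⌋₊ / c), (μ g : ℝ) * c *
        ∑ k₁ ∈ Icc 1 (⌊qhat q ^ Δ'⌋₊ / (c * g)), ∑ k₂ ∈ Icc 1 (⌊qhat q ^ Δ'⌋₊ / (c * g)),
          ((μ (c * g * k₁) : ℝ) * ((psi (c * g * k₁))⁻¹ *
              P.eval (Real.log (qhat q ^ Δ' / ((c * g * k₁ : ℕ) : ℝ)) / Real.log (qhat q ^ Δ'))) / ((c * g * k₁ : ℕ) : ℝ)) *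
            ((μ (c * g * k₂) : ℝ) * ((psi (c * g * k₂))⁻¹ *
              P.eval (Real.log (qhat q ^ Δ' / ((c * g * k₂ : ℕ) : ℝ)) / Real.log (qhat q ^ Δ'))) / ((c * g * k₂ : ℕ) : ℝ)) *
            ((k₁.divisors.card : ℝ) * (k₂.divisors.card : ℝ) *
              (((2 * (Real.log (qhat q) - Real.log g) - Real.log k₁ - Real.log k₂) ^ (8 : ℕ) - 4 * (2 * (Real.log (qhat q) - Real.log g) - Real.log k₁ - Real.log k₂) ^ (6 : ℕ) * ((∑ p ∈ k₁.primeFactors, Real.log p ^ (2 : ℕ)) + ∑ p ∈ k₂.primeFactors, Real.log p ^ (2 : ℕ)) + 18 * (2 * (Real.log (qhat q) - Real.log g) - Real.log k₁ - Real.log k₂) ^ (4 : ℕ) * ((∑ p ∈ k₁.primeFactors, Real.log p ^ (2 : ℕ)) + ∑ p ∈ k₂.primeFactors, Real.log p ^ (2 : ℕ)) ^ (2 : ℕ) - 60 * (2 * (Real.log (qhat q) - Real.log g) - Real.log k₁ - Real.log k₂) ^ (2 : ℕ) * ((∑ p ∈ k₁.primeFactors, Real.log p ^ (2 : ℕ))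 + ∑ p ∈ k₂.primeFactors, Real.log p ^ (2 : ℕ)) ^ (3 : ℕ) - 12 * (2 * (Real.log (qhat q) - Real.log g) - Real.log k₁ - Real.log k₂) ^ (4 : ℕ) * ((∑ p ∈ k₁.primeFactors, Real.log p ^ (4 : ℕ)) + ∑ p ∈ k₂.primeFactors, Real.log p ^ (4 : ℕ)) + 120 * (2 * (Real.log (qhat q) - Real.log g) - Real.log k₁ - Real.log k₂) ^ (2 : ℕ) * ((∑ p ∈ k₁.primeFactors, Real.log p ^ (2 : ℕ)) +
                ∑ p ∈ k₂.primeFactors, Real.log p ^ (2 : ℕ)) * ((∑ p ∈ k₁.primeFactors, Real.log p ^ (4 : ℕ)) + ∑ p ∈ k₂.primeFactors, Real.log p ^ (4 : ℕ)) + 105 * ((∑ p ∈ k₁.primeFactors, Real.log p ^ (2 : ℕ)) + ∑ p ∈ k₂.primeFactors, Real.log p ^ (2 : ℕ)) ^ (4 : ℕ) - 64 * (2 * (Real.log (qhat q) - Real.log g) - Real.log k₁ - Real.log k₂) ^ (2 : ℕ) * ((∑ p ∈ k₁.primeFactors, Real.log p ^ (6 : ℕ)) + ∑ p ∈ k₂.primeFactors,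 Real.log p ^ (6 : ℕ)) - 420 * ((∑ p ∈ k₁.primeFactors, Real.log p ^ (2 : ℕ)) + ∑ p ∈ k₂.primeFactors, Real.log p ^ (2 : ℕ)) ^ (2 : ℕ) * ((∑ p ∈ k₁.primeFactors, Real.log p ^ (4 : ℕ)) + ∑ p ∈ k₂.primeFactors, Real.log p ^ (4 : ℕ)) + 448 * ((∑ p ∈ k₁.primeFactors, Real.log p ^ (2 : ℕ)) + ∑ p ∈ k₂.primeFactors, Real.log p ^ (2 : ℕ)) * ((∑ p ∈ k₁.primeFactors, Real.log p ^ (6 : ℕ)) + ∑ p ∈ k₂.primeFactors, Real.log p ^ (6 : ℕ)) + 140 * ((∑ p ∈ k₁.primeFactors, Real.log p ^ (4 : ℕ)) + ∑ p ∈ k₂.primeFactors, Real.log p ^ (4 : ℕ)) ^ (2 : ℕ) - 272 *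
                ((∑ p ∈ k₁.primeFactors, Real.log p ^ (8 : ℕ)) + ∑ p ∈ k₂.primeFactors, Real.log p ^ (8 : ℕ))) / 256 * ((∫ u₁ in Ioi (0 : ℝ), ∫ u₂ in Ioi ((((g * g * (k₁ * k₂) : ℕ) : ℝ) / qhat q ^ (2 : ℕ)) / u₁), Real.exp (-(u₁ + u₂)) / (1 - Real.exp (-(u₁ + u₂))) ^ (2 : ℕ)) - (Real.log (qhat q ^ (2 : ℕ) / ((g * g * (k₁ * k₂) : ℕ) : ℝ)) / 2 + E₀₀)) +
              ((2 * (Real.log (qhat q) - Real.log g) - Real.log k₁ - Real.log k₂) ^ (7 : ℕ) - 3 * (2 * (Real.log (qhat q) - Real.log g) - Real.log k₁ - Real.log k₂) ^ (5 : ℕ) * ((∑ p ∈ k₁.primeFactors, Real.log p ^ (2 : ℕ)) + ∑ p ∈ k₂.primeFactors, Real.log p ^ (2 : ℕ)) + 9 * (2 * (Real.log (qhat q) - Real.log g) - Real.log k₁ - Real.log k₂) ^ (3 : ℕ) * ((∑ p ∈ k₁.primeFactors, Real.log p ^ (2 : ℕ)) + ∑ p ∈ k₂.primeFactors, Real.log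 p ^ (2 : ℕ)) ^ (2 : ℕ) - 15 * (2 * (Real.log (qhat q) - Real.log g) - Real.log k₁ - Real.log k₂) * ((∑ p ∈ k₁.primeFactors, Real.log p ^ (2 : ℕ)) + ∑ p ∈ k₂.primeFactors, Real.log p ^ (2 : ℕ)) ^ (3 : ℕ) - 6 * (2 * (Real.log (qhat q) - Real.log g) - Real.log k₁ - Real.log k₂) ^ (3 : ℕ) * ((∑ p ∈ k₁.primeFactors, Real.log p ^ (4 : ℕ)) + ∑ p ∈ k₂.primeFactors, Real.log p ^ (4 : ℕ)) + 30 * (2 * (Real.log (qhat q) - Real.log g) - Real.log k₁ - Real.log k₂) * ((∑ p ∈ k₁.primeFactors, Real.log p ^ (2 : ℕ)) + ∑ p ∈ k₂.primeFactors, Real.log p ^ (2 : ℕ)) *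
                ((∑ p ∈ k₁.primeFactors, Real.log p ^ (4 : ℕ)) + ∑ p ∈ k₂.primeFactors, Real.log p ^ (4 : ℕ)) - 16 * (2 * (Real.log (qhat q) - Real.log g) - Real.log k₁ - Real.log k₂) * ((∑ p ∈ k₁.primeFactors, Real.log p ^ (6 : ℕ)) + ∑ p ∈ k₂.primeFactors, Real.log p ^ (6 : ℕ))) / 32 * ((∫ u₁ in Ioi (0 : ℝ), ∫ u₂ in Ioi ((((g * g * (k₁ * k₂) : ℕ) : ℝ) / qhat q ^ (2 : ℕ)) / u₁), Real.exp (-(u₁ + u₂)) / (1 - Real.exp (-(u₁ + u₂))) ^ (2 : ℕ) * Real.log u₂) - (-(Real.log (qhat q ^ (2 : ℕ) / ((g * g * (k₁ * k₂) : ℕ) : ℝ)) ^ (2 : ℕ)) / 8 + E₀₁)) +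
              (3 * (2 * (Real.log (qhat q) - Real.log g) - Real.log k₁ - Real.log k₂) ^ (6 : ℕ) - 3 * (2 * (Real.log (qhat q) - Real.log g) - Real.log k₁ - Real.log k₂) ^ (4 : ℕ) * ((∑ p ∈ k₁.primeFactors, Real.log p ^ (2 : ℕ)) + ∑ p ∈ k₂.primeFactors, Real.log p ^ (2 : ℕ)) - 9 * (2 * (Real.log (qhat q) - Real.log g) - Real.log k₁ - Real.log k₂) ^ (2 : ℕ) * ((∑ p ∈ k₁.primeFactors, Real.log p ^ (2 : ℕ)) + ∑ p ∈ k₂.primeFactors, Real.log p ^ (2 : ℕ)) ^ (2 : ℕ) + 6 * (2 * (Real.log (qhat q) - Real.log g) - Real.log k₁ - Real.log k₂) ^ (2 : ℕ) * ((∑ p ∈ k₁.primeFactors, Real.log p ^ (4 : ℕ)) + ∑ p ∈ k₂.primeFactors, Real.log p ^ (4 : ℕ)) + 45 * ((∑ p ∈ k₁.primeFactors, Real.log p ^ (2 : ℕ)) + ∑ p ∈ k₂.primeFactors, Real.log p ^ (2 : ℕ)) ^ (3 : ℕ) - 90 * ((∑ p ∈ k₁.primeFactors, Real.log p ^ (2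 : ℕ)) + ∑ p ∈ k₂.primeFactors, Real.log p ^ (2 : ℕ)) * ((∑ p ∈ k₁.primeFactors, Real.log p ^ (4 : ℕ)) + ∑ p ∈ k₂.primeFactors, Real.log p ^ (4 : ℕ)) + 48 *
                ((∑ p ∈ k₁.primeFactors, Real.log p ^ (6 : ℕ)) + ∑ p ∈ k₂.primeFactors, Real.log p ^ (6 : ℕ))) / 32 * ((∫ u₁ in Ioi (0 : ℝ), ∫ u₂ in Ioi ((((g * g * (k₁ * k₂) : ℕ) : ℝ) / qhat q ^ (2 : ℕ)) / u₁), Real.exp (-(u₁ + u₂)) / (1 - Real.exp (-(u₁ + u₂))) ^ (2 : ℕ) * Real.log u₂ ^ (2 : ℕ)) - (Real.log (qhat q ^ (2 : ℕ) / ((g * g * (k₁ * k₂) : ℕ) : ℝ)) ^ (3 : ℕ) / 24 + 2 * μ₂ * Real.log (qhat q ^ (2 : ℕ) / ((g * g * (k₁ * k₂) : ℕ) : ℝ)) + E₀₂)) +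
              ((2 * (Real.log (qhat q) - Real.log g) - Real.log k₁ - Real.log k₂) ^ (5 : ℕ) + 2 * (2 * (Real.log (qhat q) - Real.log g) - Real.log k₁ - Real.log k₂) ^ (3 : ℕ) * ((∑ p ∈ k₁.primeFactors, Real.log p ^ (2 : ℕ)) + ∑ p ∈ k₂.primeFactors, Real.log p ^ (2 : ℕ)) - 9 * (2 * (Real.log (qhat q) - Real.log g) - Real.log k₁ - Real.log k₂) * ((∑ p ∈ k₁.primeFactors, Real.log p ^ (2 : ℕ)) + ∑ p ∈ k₂.primeFactors, Real.log p ^ (2 : ℕ)) ^ (2 : ℕ) + 6 * (2 * (Real.log (qhat q) - Real.log g) - Real.log k₁ - Real.log k₂) * ((∑ p ∈ k₁.primeFactors, Real.log p ^ (4 : ℕ)) + ∑ p ∈ k₂.primeFactors, Real.log p ^ (4 : ℕ))) / 8 * ((∫ u₁ in Ioi (0 : ℝ), ∫ u₂ in Ioi ((((g * g * (k₁ * k₂) : ℕ) : ℝ) / qhat q ^ (2 : ℕ)) / u₁), Real.exp (-(u₁ + u₂)) / (1 - Real.exp (-(u₁ + u₂))) ^ (2 : ℕ) * Real.log u₂ ^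 (3 : ℕ)) - (-(Real.log (qhat q ^ (2 : ℕ) / ((g * g * (k₁ * k₂) : ℕ) : ℝ)) ^ (4 : ℕ)) / 64 - 3 * μ₂ / 2 * Real.log (qhat q ^ (2 : ℕ) / ((g * g * (k₁ * k₂) : ℕ) : ℝ)) ^ (2 : ℕ) + E₀₃)) +
              ((2 * (Real.log (qhat q) - Real.log g) - Real.log k₁ - Real.log k₂) ^ (4 : ℕ) + 6 * (2 * (Real.log (qhat q) - Real.log g) - Real.log k₁ - Real.log k₂) ^ (2 : ℕ) * ((∑ p ∈ k₁.primeFactors, Real.log p ^ (2 : ℕ)) + ∑ p ∈ k₂.primeFactors, Real.log p ^ (2 : ℕ)) + 3 * ((∑ p ∈ k₁.primeFactors, Real.log p ^ (2 : ℕ)) + ∑ p ∈ k₂.primeFactors, Real.log p ^ (2 : ℕ)) ^ (2 : ℕ) - 2 * ((∑ p ∈ k₁.primeFactors, Real.log p ^ (4 : ℕ)) + ∑ p ∈ k₂.primeFactors, Real.log p ^ (4 : ℕ))) / 16 * ((∫ u₁ in Ioi (0 : ℝ), ∫ u₂ in Ioi ((((g * g * (k₁ * k₂) : ℕ) : ℝ)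 / qhat q ^ (2 : ℕ)) / u₁), Real.exp (-(u₁ + u₂)) / (1 - Real.exp (-(u₁ + u₂))) ^ (2 : ℕ) * Real.log u₂ ^ (4 : ℕ)) - (Real.log (qhat q ^ (2 : ℕ) / ((g * g * (k₁ * k₂) : ℕ) : ℝ)) ^ (5 : ℕ) / 160 + μ₂ * Real.log (qhat q ^ (2 : ℕ) / ((g * g * (k₁ * k₂) : ℕ) : ℝ)) ^ (3 : ℕ) + 2 * μ₄ * Real.log (qhat q ^ (2 : ℕ) / ((g * g * (k₁ * k₂) : ℕ) : ℝ)) + E₀₄)) +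
              ((2 * (Real.log (qhat q) - Real.log g) - Real.log k₁ - Real.log k₂) ^ (7 : ℕ) - 3 * (2 * (Real.log (qhat q) - Real.log g) - Real.log k₁ - Real.log k₂) ^ (5 : ℕ) * ((∑ p ∈ k₁.primeFactors, Real.log p ^ (2 : ℕ)) + ∑ p ∈ k₂.primeFactors, Real.log p ^ (2 : ℕ)) + 9 * (2 * (Real.log (qhat q) - Real.log g) - Real.log k₁ - Real.log k₂) ^ (3 : ℕ) * ((∑ p ∈ k₁.primeFactors, Real.log p ^ (2 : ℕ)) + ∑ p ∈ k₂.primeFactors, Real.log p ^ (2 : ℕ)) ^ (2 : ℕ) - 15 * (2 * (Real.log (qhat q) - Real.log g) - Real.log k₁ - Real.log k₂) * ((∑ p ∈ k₁.primeFactors, Real.log p ^ (2 : ℕ)) + ∑ p ∈ k₂.primeFactors, Real.log p ^ (2 : ℕ)) ^ (3 : ℕ) - 6 * (2 * (Real.log (qhat q) - Real.log g) - Real.log k₁ - Real.log k₂) ^ (3 : ℕ) * ((∑ p ∈ k₁.primeFactors, Real.log p ^ (4 : ℕ)) + ∑ p ∈ k₂.primeFactors, Real.log p ^ (4 : ℕ))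 + 30 * (2 * (Real.log (qhat q) - Real.log g) - Real.log k₁ - Real.log k₂) * ((∑ p ∈ k₁.primeFactors, Real.log p ^ (2 : ℕ)) + ∑ p ∈ k₂.primeFactors, Real.log p ^ (2 : ℕ)) *
                ((∑ p ∈ k₁.primeFactors, Real.log p ^ (4 : ℕ)) + ∑ p ∈ k₂.primeFactors, Real.log p ^ (4 : ℕ)) - 16 * (2 * (Real.log (qhat q) - Real.log g) - Real.log k₁ - Real.log k₂) * ((∑ p ∈ k₁.primeFactors, Real.log p ^ (6 : ℕ)) + ∑ p ∈ k₂.primeFactors, Real.log p ^ (6 : ℕ))) / 32 * ((∫ u₁ in Ioi (0 : ℝ), Real.log u₁ * ∫ u₂ in Ioi ((((g * g * (k₁ * k₂) : ℕ) : ℝ) / qhat q ^ (2 : ℕ)) / u₁), Real.exp (-(u₁ + u₂)) / (1 - Real.exp (-(u₁ + u₂))) ^ (2 : ℕ)) - (-(Real.log (qhat q ^ (2 : ℕ) / ((g * g * (k₁ * k₂) : ℕ) : ℝ)) ^ (2 : ℕ)) / 8 + E₁₀)) +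
              ((2 * (Real.log (qhat q) - Real.log g) - Real.log k₁ - Real.log k₂) ^ (6 : ℕ) - 3 * (2 * (Real.log (qhat q) - Real.log g) - Real.log k₁ - Real.log k₂) ^ (4 : ℕ) * ((∑ p ∈ k₁.primeFactors, Real.log p ^ (2 : ℕ)) + ∑ p ∈ k₂.primeFactors, Real.log p ^ (2 : ℕ)) + 9 * (2 * (Real.log (qhat q) - Real.log g) - Real.log k₁ - Real.log k₂) ^ (2 : ℕ) * ((∑ p ∈ k₁.primeFactors, Real.log p ^ (2 : ℕ)) + ∑ p ∈ k₂.primeFactors, Real.log p ^ (2 : ℕ)) ^ (2 : ℕ) - 6 * (2 * (Real.log (qhat q) - Real.log g) - Real.log k₁ - Real.log k₂) ^ (2 : ℕ) * ((∑ p ∈ k₁.primeFactors, Real.log p ^ (4 : ℕ)) + ∑ p ∈ k₂.primeFactors, Real.log p ^ (4 : ℕ)) - 15 * ((∑ p ∈ k₁.primeFactors, Real.log p ^ (2 : ℕ)) + ∑ p ∈ k₂.primeFactors, Real.log p ^ (2 : ℕ)) ^ (3 : ℕ) + 30 * ((∑ p ∈ k₁.primeFactors, Real.log p ^ (2 : ℕ))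 + ∑ p ∈ k₂.primeFactors, Real.log p ^ (2 : ℕ)) * ((∑ p ∈ k₁.primeFactors, Real.log p ^ (4 : ℕ)) + ∑ p ∈ k₂.primeFactors, Real.log p ^ (4 : ℕ)) - 16 *
                ((∑ p ∈ k₁.primeFactors, Real.log p ^ (6 : ℕ)) + ∑ p ∈ k₂.primeFactors, Real.log p ^ (6 : ℕ))) / 4 * ((∫ u₁ in Ioi (0 : ℝ), Real.log u₁ * ∫ u₂ in Ioi ((((g * g * (k₁ * k₂) : ℕ) : ℝ) / qhat q ^ (2 : ℕ)) / u₁), Real.exp (-(u₁ + u₂)) / (1 - Real.exp (-(u₁ + u₂))) ^ (2 : ℕ) * Real.log u₂) - (Real.log (qhat q ^ (2 : ℕ) / ((g * g * (k₁ * k₂) : ℕ) : ℝ)) ^ (3 : ℕ) / 24 - 2 * μ₂ * Real.log (qhat q ^ (2 : ℕ) / ((g * g * (k₁ * k₂) : ℕ) : ℝ)) + E₁₁)) +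
              (3 * (2 * (Real.log (qhat q) - Real.log g) - Real.log k₁ - Real.log k₂) ^ (5 : ℕ) - 6 * (2 * (Real.log (qhat q) - Real.log g) - Real.log k₁ - Real.log k₂) ^ (3 : ℕ) * ((∑ p ∈ k₁.primeFactors, Real.log p ^ (2 : ℕ)) + ∑ p ∈ k₂.primeFactors, Real.log p ^ (2 : ℕ)) + 9 * (2 * (Real.log (qhat q) - Real.log g) - Real.log k₁ - Real.log k₂) * ((∑ p ∈ k₁.primeFactors, Real.log p ^ (2 : ℕ)) + ∑ p ∈ k₂.primeFactors, Real.log p ^ (2 : ℕ)) ^ (2 : ℕ) - 6 * (2 * (Real.log (qhat q) - Real.log g) - Real.log k₁ - Real.log k₂) * ((∑ p ∈ k₁.primeFactors, Real.log p ^ (4 : ℕ)) + ∑ p ∈ k₂.primeFactors, Real.log p ^ (4 : ℕ))) / 4 * ((∫ u₁ in Ioi (0 : ℝ), Real.log u₁ * ∫ u₂ in Ioi ((((g * g * (k₁ * k₂) : ℕ) : ℝ) / qhat q ^ (2 : ℕ)) / u₁), Real.exp (-(u₁ + u₂)) / (1 - Real.exp (-(u₁ + u₂))) ^ (2 : ℕ)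 * Real.log u₂ ^ (2 : ℕ)) - (-(Real.log (qhat q ^ (2 : ℕ) / ((g * g * (k₁ * k₂) : ℕ) : ℝ)) ^ (4 : ℕ)) / 64 + μ₂ / 2 * Real.log (qhat q ^ (2 : ℕ) / ((g * g * (k₁ * k₂) : ℕ) : ℝ)) ^ (2 : ℕ) + E₁₂)) +
              ((2 * (Real.log (qhat q) - Real.log g) - Real.log k₁ - Real.log k₂) ^ (4 : ℕ) - 3 * ((∑ p ∈ k₁.primeFactors, Real.log p ^ (2 : ℕ)) + ∑ p ∈ k₂.primeFactors, Real.log p ^ (2 : ℕ)) ^ (2 : ℕ) + 2 * ((∑ p ∈ k₁.primeFactors, Real.log p ^ (4 : ℕ)) + ∑ p ∈ k₂.primeFactors, Real.log p ^ (4 : ℕ))) * ((∫ u₁ in Ioi (0 : ℝ), Real.log u₁ * ∫ u₂ in Ioi ((((g * g * (k₁ * k₂) : ℕ) : ℝ) / qhat q ^ (2 : ℕ)) / u₁), Real.exp (-(u₁ + u₂)) / (1 - Real.exp (-(u₁ + u₂))) ^ (2 : ℕ) * Real.log u₂ ^ (3 : ℕ)) - (Real.log (qhat q ^ (2 : ℕ)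 / ((g * g * (k₁ * k₂) : ℕ) : ℝ)) ^ (5 : ℕ) / 160 - 2 * μ₄ * Real.log (qhat q ^ (2 : ℕ) / ((g * g * (k₁ * k₂) : ℕ) : ℝ)) + E₁₃)) +
              ((2 * (Real.log (qhat q) - Real.log g) - Real.log k₁ - Real.log k₂) ^ (3 : ℕ) + 3 * (2 * (Real.log (qhat q) - Real.log g) - Real.log k₁ - Real.log k₂) * ((∑ p ∈ k₁.primeFactors, Real.log p ^ (2 : ℕ)) + ∑ p ∈ k₂.primeFactors, Real.log p ^ (2 : ℕ))) / 2 * ((∫ u₁ in Ioi (0 : ℝ), Real.log u₁ * ∫ u₂ in Ioi ((((g * g * (k₁ * k₂) : ℕ) : ℝ) / qhat q ^ (2 : ℕ)) / u₁), Real.exp (-(u₁ + u₂)) / (1 - Real.exp (-(u₁ + u₂))) ^ (2 : ℕ) * Real.log u₂ ^ (4 : ℕ)) - (-(Real.log (qhat q ^ (2 : ℕ) / ((g * g * (k₁ * k₂) : ℕ) : ℝ)) ^ (6 : ℕ)) / 384 - μ₂ / 8 * Real.log (qhat q ^ (2 : ℕ) / ((g * g * (k₁ * k₂) : ℕ) :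 ℝ)) ^ (4 : ℕ) + 3 * μ₄ / 2 * Real.log (qhat q ^ (2 : ℕ) / ((g * g * (k₁ * k₂) : ℕ) : ℝ)) ^ (2 : ℕ) + E₁₄)) +
              (3 * (2 * (Real.log (qhat q) - Real.log g) - Real.log k₁ - Real.log k₂) ^ (6 : ℕ) - 3 * (2 * (Real.log (qhat q) - Real.log g) - Real.log k₁ - Real.log k₂) ^ (4 : ℕ) * ((∑ p ∈ k₁.primeFactors, Real.log p ^ (2 : ℕ)) + ∑ p ∈ k₂.primeFactors, Real.log p ^ (2 : ℕ)) - 9 * (2 * (Real.log (qhat q) - Real.log g) - Real.log k₁ - Real.log k₂) ^ (2 : ℕ) * ((∑ p ∈ k₁.primeFactors, Real.log p ^ (2 : ℕ)) + ∑ p ∈ k₂.primeFactors, Real.log p ^ (2 : ℕ)) ^ (2 : ℕ) + 6 * (2 * (Real.log (qhat q) - Real.log g) - Real.log k₁ - Real.log k₂) ^ (2 : ℕ) * ((∑ p ∈ k₁.primeFactors, Real.log p ^ (4 : ℕ)) + ∑ p ∈ k₂.primeFactors, Real.log p ^ (4 : ℕ)) + 45 * ((∑ p ∈ k₁.primeFactors,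 Real.log p ^ (2 : ℕ)) + ∑ p ∈ k₂.primeFactors, Real.log p ^ (2 : ℕ)) ^ (3 : ℕ) - 90 * ((∑ p ∈ k₁.primeFactors, Real.log p ^ (2 : ℕ)) + ∑ p ∈ k₂.primeFactors, Real.log p ^ (2 : ℕ)) * ((∑ p ∈ k₁.primeFactors, Real.log p ^ (4 : ℕ)) + ∑ p ∈ k₂.primeFactors, Real.log p ^ (4 : ℕ)) + 48 *
                ((∑ p ∈ k₁.primeFactors, Real.log p ^ (6 : ℕ)) + ∑ p ∈ k₂.primeFactors, Real.log p ^ (6 : ℕ))) / 32 * ((∫ u₁ in Ioi (0 : ℝ), Real.log u₁ ^ (2 : ℕ) * ∫ u₂ in Ioi ((((g * g * (k₁ * k₂) : ℕ) : ℝ) / qhat q ^ (2 : ℕ)) / u₁), Real.exp (-(u₁ + u₂)) / (1 - Real.exp (-(u₁ + u₂))) ^ (2 : ℕ)) - (Real.log (qhat q ^ (2 : ℕ) / ((g * g * (k₁ * k₂) : ℕ) : ℝ)) ^ (3 : ℕ) / 24 + 2 * μ₂ * Real.log (qhat q ^ (2 : ℕ) / ((g * g * (k₁ * k₂) : ℕ)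 : ℝ)) + E₂₀)) +
              (3 * (2 * (Real.log (qhat q) - Real.log g) - Real.log k₁ - Real.log k₂) ^ (5 : ℕ) - 6 * (2 * (Real.log (qhat q) - Real.log g) - Real.log k₁ - Real.log k₂) ^ (3 : ℕ) * ((∑ p ∈ k₁.primeFactors, Real.log p ^ (2 : ℕ)) + ∑ p ∈ k₂.primeFactors, Real.log p ^ (2 : ℕ)) + 9 * (2 * (Real.log (qhat q) - Real.log g) - Real.log k₁ - Real.log k₂) * ((∑ p ∈ k₁.primeFactors, Real.log p ^ (2 : ℕ)) + ∑ p ∈ k₂.primeFactors, Real.log p ^ (2 : ℕ)) ^ (2 : ℕ) - 6 * (2 * (Real.log (qhat q) - Real.log g) - Real.log k₁ - Real.log k₂) * ((∑ p ∈ k₁.primeFactors, Real.log p ^ (4 : ℕ)) + ∑ p ∈ k₂.primeFactors, Real.log p ^ (4 : ℕ))) / 4 * ((∫ u₁ in Ioi (0 : ℝ), Real.log u₁ ^ (2 : ℕ) * ∫ u₂ in Ioi ((((g * g * (k₁ * k₂) : ℕ) : ℝ) / qhat q ^ (2 : ℕ)) / u₁), Real.exp (-(u₁ + u₂)) / (1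 - Real.exp (-(u₁ + u₂))) ^ (2 : ℕ) * Real.log u₂) - (-(Real.log (qhat q ^ (2 : ℕ) / ((g * g * (k₁ * k₂) : ℕ) : ℝ)) ^ (4 : ℕ)) / 64 + μ₂ / 2 * Real.log (qhat q ^ (2 : ℕ) / ((g * g * (k₁ * k₂) : ℕ) : ℝ)) ^ (2 : ℕ) + E₂₁)) +
              (9 * (2 * (Real.log (qhat q) - Real.log g) - Real.log k₁ - Real.log k₂) ^ (4 : ℕ) - 18 * (2 * (Real.log (qhat q) - Real.log g) - Real.log k₁ - Real.log k₂) ^ (2 : ℕ) * ((∑ p ∈ k₁.primeFactors, Real.log p ^ (2 : ℕ)) + ∑ p ∈ k₂.primeFactors, Real.log p ^ (2 : ℕ)) + 27 * ((∑ p ∈ k₁.primeFactors, Real.log p ^ (2 : ℕ)) + ∑ p ∈ k₂.primeFactors, Real.log p ^ (2 : ℕ)) ^ (2 : ℕ) - 18 * ((∑ p ∈ k₁.primeFactors, Real.log p ^ (4 : ℕ)) + ∑ p ∈ k₂.primeFactors, Real.log p ^ (4 : ℕ))) / 4 * ((∫ u₁ in Ioi (0 : ℝ), Real.log u₁ ^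 (2 : ℕ) * ∫ u₂ in Ioi ((((g * g * (k₁ * k₂) : ℕ) : ℝ) / qhat q ^ (2 : ℕ)) / u₁), Real.exp (-(u₁ + u₂)) / (1 - Real.exp (-(u₁ + u₂))) ^ (2 : ℕ) * Real.log u₂ ^ (2 : ℕ)) - (Real.log (qhat q ^ (2 : ℕ) / ((g * g * (k₁ * k₂) : ℕ) : ℝ)) ^ (5 : ℕ) / 160 - μ₂ / 3 * Real.log (qhat q ^ (2 : ℕ) / ((g * g * (k₁ * k₂) : ℕ) : ℝ)) ^ (3 : ℕ) + 2 * μ₄ * Real.log (qhat q ^ (2 : ℕ) / ((g * g * (k₁ * k₂) : ℕ) : ℝ)) + E₂₂)) +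
              (3 * (2 * (Real.log (qhat q) - Real.log g) - Real.log k₁ - Real.log k₂) ^ (3 : ℕ) - 3 * (2 * (Real.log (qhat q) - Real.log g) - Real.log k₁ - Real.log k₂) * ((∑ p ∈ k₁.primeFactors, Real.log p ^ (2 : ℕ)) + ∑ p ∈ k₂.primeFactors, Real.log p ^ (2 : ℕ))) * ((∫ u₁ in Ioi (0 : ℝ), Real.log u₁ ^ (2 : ℕ) * ∫ u₂ in Ioi ((((g * g * (k₁ * k₂) : ℕ) : ℝ) / qhat q ^ (2 : ℕ)) / u₁), Real.exp (-(u₁ + u₂)) / (1 - Real.exp (-(u₁ + u₂))) ^ (2 : ℕ) * Real.log u₂ ^ (3 : ℕ)) - (-(Real.log (qhat q ^ (2 : ℕ) / ((g * g * (k₁ * k₂) : ℕ) : ℝ)) ^ (6 : ℕ)) / 384 + μ₂ / 8 * Real.log (qhat q ^ (2 : ℕ) / ((g * g * (k₁ * k₂) : ℕ) : ℝ)) ^ (4 : ℕ) - μ₄ / 2 * Real.log (qhat q ^ (2 : ℕ) / ((g * g * (k₁ * k₂) : ℕ) : ℝ)) ^ (2 : ℕ) + E₂₃)) +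
              (3 * (2 * (Real.log (qhat q) - Real.log g) - Real.log k₁ - Real.log k₂) ^ (2 : ℕ) + 3 * ((∑ p ∈ k₁.primeFactors, Real.log p ^ (2 : ℕ)) + ∑ p ∈ k₂.primeFactors, Real.log p ^ (2 : ℕ))) / 2 * ((∫ u₁ in Ioi (0 : ℝ), Real.log u₁ ^ (2 : ℕ) * ∫ u₂ in Ioi ((((g * g * (k₁ * k₂) : ℕ) : ℝ) / qhat q ^ (2 : ℕ)) / u₁), Real.exp (-(u₁ + u₂)) / (1 - Real.exp (-(u₁ + u₂))) ^ (2 : ℕ) * Real.log u₂ ^ (4 : ℕ)) - (Real.log (qhat q ^ (2 : ℕ) / ((g * g * (k₁ * k₂) : ℕ) : ℝ)) ^ (7 : ℕ) / 896 - μ₂ / 40 * Real.log (qhat q ^ (2 : ℕ) / ((g * g * (k₁ * k₂) : ℕ) : ℝ)) ^ (5 : ℕ) - μ₄ / 6 * Real.log (qhat q ^ (2 : ℕ) / ((g * g * (k₁ * k₂) : ℕ) : ℝ)) ^ (3 : ℕ) + 2 * μ₆ * Real.log (qhat q ^ (2 : ℕ) / ((g * g * (k₁ * k₂) : ℕ)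 : ℝ)) + E₂₄)) +
              ((2 * (Real.log (qhat q) - Real.log g) - Real.log k₁ - Real.log k₂) ^ (5 : ℕ) + 2 * (2 * (Real.log (qhat q) - Real.log g) - Real.log k₁ - Real.log k₂) ^ (3 : ℕ) * ((∑ p ∈ k₁.primeFactors, Real.log p ^ (2 : ℕ)) + ∑ p ∈ k₂.primeFactors, Real.log p ^ (2 : ℕ)) - 9 * (2 * (Real.log (qhat q) - Real.log g) - Real.log k₁ - Real.log k₂) * ((∑ p ∈ k₁.primeFactors, Real.log p ^ (2 : ℕ)) + ∑ p ∈ k₂.primeFactors, Real.log p ^ (2 : ℕ)) ^ (2 : ℕ) + 6 * (2 * (Real.log (qhat q) - Real.log g) - Real.log k₁ - Real.log k₂) * ((∑ p ∈ k₁.primeFactors, Real.log p ^ (4 : ℕ)) + ∑ p ∈ k₂.primeFactors, Real.log p ^ (4 : ℕ))) / 8 * ((∫ u₁ in Ioi (0 : ℝ), Real.log u₁ ^ (3 : ℕ) * ∫ u₂ in Ioi ((((g * g * (k₁ * k₂) : ℕ) : ℝ) / qhat q ^ (2 : ℕ)) / u₁), Real.exp (-(u₁ + u₂)) / (1 - Real.exp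 (-(u₁ + u₂))) ^ (2 : ℕ)) - (-(Real.log (qhat q ^ (2 : ℕ) / ((g * g * (k₁ * k₂) : ℕ) : ℝ)) ^ (4 : ℕ)) / 64 - 3 * μ₂ / 2 * Real.log (qhat q ^ (2 : ℕ) / ((g * g * (k₁ * k₂) : ℕ) : ℝ)) ^ (2 : ℕ) + E₃₀)) +
              ((2 * (Real.log (qhat q) - Real.log g) - Real.log k₁ - Real.log k₂) ^ (4 : ℕ) - 3 * ((∑ p ∈ k₁.primeFactors, Real.log p ^ (2 : ℕ)) + ∑ p ∈ k₂.primeFactors, Real.log p ^ (2 : ℕ)) ^ (2 : ℕ) + 2 * ((∑ p ∈ k₁.primeFactors, Real.log p ^ (4 : ℕ)) + ∑ p ∈ k₂.primeFactors, Real.log p ^ (4 : ℕ))) * ((∫ u₁ in Ioi (0 : ℝ), Real.log u₁ ^ (3 : ℕ) * ∫ u₂ in Ioi ((((g * g * (k₁ * k₂) : ℕ) : ℝ) / qhat q ^ (2 : ℕ)) / u₁), Real.exp (-(u₁ + u₂)) / (1 - Real.exp (-(u₁ + u₂))) ^ (2 : ℕ) * Real.log u₂) - (Real.log (qhat q ^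 (2 : ℕ) / ((g * g * (k₁ * k₂) : ℕ) : ℝ)) ^ (5 : ℕ) / 160 - 2 * μ₄ * Real.log (qhat q ^ (2 : ℕ) / ((g * g * (k₁ * k₂) : ℕ) : ℝ)) + E₃₁)) +
              (3 * (2 * (Real.log (qhat q) - Real.log g) - Real.log k₁ - Real.log k₂) ^ (3 : ℕ) - 3 * (2 * (Real.log (qhat q) - Real.log g) - Real.log k₁ - Real.log k₂) * ((∑ p ∈ k₁.primeFactors, Real.log p ^ (2 : ℕ)) + ∑ p ∈ k₂.primeFactors, Real.log p ^ (2 : ℕ))) * ((∫ u₁ in Ioi (0 : ℝ), Real.log u₁ ^ (3 : ℕ) * ∫ u₂ in Ioi ((((g * g * (k₁ * k₂) : ℕ) : ℝ) / qhat q ^ (2 : ℕ)) / u₁), Real.exp (-(u₁ + u₂)) / (1 - Real.exp (-(u₁ + u₂))) ^ (2 : ℕ) * Real.log u₂ ^ (2 : ℕ)) - (-(Real.log (qhat q ^ (2 : ℕ) / ((g * g * (k₁ * k₂) : ℕ) : ℝ)) ^ (6 : ℕ)) / 384 + μ₂ / 8 * Real.log (qhat q ^ (2 : ℕ) / ((g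 * g * (k₁ * k₂) : ℕ) : ℝ)) ^ (4 : ℕ) - μ₄ / 2 * Real.log (qhat q ^ (2 : ℕ) / ((g * g * (k₁ * k₂) : ℕ) : ℝ)) ^ (2 : ℕ) + E₃₂)) +
              (4 * (2 * (Real.log (qhat q) - Real.log g) - Real.log k₁ - Real.log k₂) ^ (2 : ℕ) - 4 * ((∑ p ∈ k₁.primeFactors, Real.log p ^ (2 : ℕ)) + ∑ p ∈ k₂.primeFactors, Real.log p ^ (2 : ℕ))) * ((∫ u₁ in Ioi (0 : ℝ), Real.log u₁ ^ (3 : ℕ) * ∫ u₂ in Ioi ((((g * g * (k₁ * k₂) : ℕ) : ℝ) / qhat q ^ (2 : ℕ)) / u₁), Real.exp (-(u₁ + u₂)) / (1 - Real.exp (-(u₁ + u₂))) ^ (2 : ℕ) * Real.log u₂ ^ (3 : ℕ)) - (Real.log (qhat q ^ (2 : ℕ) / ((g * g * (k₁ * k₂) : ℕ) : ℝ)) ^ (7 : ℕ) / 896 - 3 * μ₂ / 40 * Real.log (qhat q ^ (2 : ℕ) / ((g * g * (k₁ * k₂) : ℕ) : ℝ)) ^ (5 : ℕ) + μ₄ /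 2 * Real.log (qhat q ^ (2 : ℕ) / ((g * g * (k₁ * k₂) : ℕ) : ℝ)) ^ (3 : ℕ) - 2 * μ₆ * Real.log (qhat q ^ (2 : ℕ) / ((g * g * (k₁ * k₂) : ℕ) : ℝ)) + E₃₃)) +
              2 * (2 * (Real.log (qhat q) - Real.log g) - Real.log k₁ - Real.log k₂) * ((∫ u₁ in Ioi (0 : ℝ), Real.log u₁ ^ (3 : ℕ) * ∫ u₂ in Ioi ((((g * g * (k₁ * k₂) : ℕ) : ℝ) / qhat q ^ (2 : ℕ)) / u₁), Real.exp (-(u₁ + u₂)) / (1 - Real.exp (-(u₁ + u₂))) ^ (2 : ℕ) * Real.log u₂ ^ (4 : ℕ)) - (-(Real.log (qhat q ^ (2 : ℕ) / ((g * g * (k₁ * k₂) : ℕ) : ℝ)) ^ (8 : ℕ)) / 2048 + μ₂ / 32 * Real.log (qhat q ^ (2 : ℕ) / ((g * g * (k₁ * k₂) : ℕ) : ℝ)) ^ (6 : ℕ) - 3 * μ₄ / 16 * Real.log (qhat q ^ (2 : ℕ) / ((g * g * (k₁ * k₂) : ℕ) : ℝ)) ^ (4 : ℕ) + μ₆ /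 2 * Real.log (qhat q ^ (2 : ℕ) / ((g * g * (k₁ * k₂) : ℕ) : ℝ)) ^ (2 : ℕ) + E₃₄)) +
              ((2 * (Real.log (qhat q) - Real.log g) - Real.log k₁ - Real.log k₂) ^ (4 : ℕ) + 6 * (2 * (Real.log (qhat q) - Real.log g) - Real.log k₁ - Real.log k₂) ^ (2 : ℕ) * ((∑ p ∈ k₁.primeFactors, Real.log p ^ (2 : ℕ)) + ∑ p ∈ k₂.primeFactors, Real.log p ^ (2 : ℕ)) + 3 * ((∑ p ∈ k₁.primeFactors, Real.log p ^ (2 : ℕ)) + ∑ p ∈ k₂.primeFactors, Real.log p ^ (2 : ℕ)) ^ (2 : ℕ) - 2 * ((∑ p ∈ k₁.primeFactors, Real.log p ^ (4 : ℕ)) + ∑ p ∈ k₂.primeFactors, Real.log p ^ (4 : ℕ))) / 16 * ((∫ u₁ in Ioi (0 : ℝ), Real.log u₁ ^ (4 : ℕ) * ∫ u₂ in Ioi ((((g * g * (k₁ * k₂) : ℕ) : ℝ) / qhat q ^ (2 : ℕ)) / u₁), Real.exp (-(u₁ + u₂)) / (1 - Real.exp (-(u₁ + u₂))) ^ (2 :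 ℕ)) - (Real.log (qhat q ^ (2 : ℕ) / ((g * g * (k₁ * k₂) : ℕ) : ℝ)) ^ (5 : ℕ) / 160 + μ₂ * Real.log (qhat q ^ (2 : ℕ) / ((g * g * (k₁ * k₂) : ℕ) : ℝ)) ^ (3 : ℕ) + 2 * μ₄ * Real.log (qhat q ^ (2 : ℕ) / ((g * g * (k₁ * k₂) : ℕ) : ℝ)) + E₄₀)) +
              ((2 * (Real.log (qhat q) - Real.log g) - Real.log k₁ - Real.log k₂) ^ (3 : ℕ) + 3 * (2 * (Real.log (qhat q) - Real.log g) - Real.log k₁ - Real.log k₂) * ((∑ p ∈ k₁.primeFactors, Real.log p ^ (2 : ℕ)) + ∑ p ∈ k₂.primeFactors, Real.log p ^ (2 : ℕ))) / 2 * ((∫ u₁ in Ioi (0 : ℝ), Real.log u₁ ^ (4 : ℕ) * ∫ u₂ in Ioi ((((g * g * (k₁ * k₂) : ℕ) : ℝ) / qhat q ^ (2 : ℕ)) / u₁), Real.exp (-(u₁ + u₂)) / (1 - Real.exp (-(u₁ + u₂))) ^ (2 : ℕ) * Real.log u₂) - (-(Real.log (qhat q ^ (2 : ℕ) / ((g *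 g * (k₁ * k₂) : ℕ) : ℝ)) ^ (6 : ℕ)) / 384 - μ₂ / 8 * Real.log (qhat q ^ (2 : ℕ) / ((g * g * (k₁ * k₂) : ℕ) : ℝ)) ^ (4 : ℕ) + 3 * μ₄ / 2 * Real.log (qhat q ^ (2 : ℕ) / ((g * g * (k₁ * k₂) : ℕ) : ℝ)) ^ (2 : ℕ) + E₄₁)) +
              (3 * (2 * (Real.log (qhat q) - Real.log g) - Real.log k₁ - Real.log k₂) ^ (2 : ℕ) + 3 * ((∑ p ∈ k₁.primeFactors, Real.log p ^ (2 : ℕ)) + ∑ p ∈ k₂.primeFactors, Real.log p ^ (2 : ℕ))) / 2 * ((∫ u₁ in Ioi (0 : ℝ), Real.log u₁ ^ (4 : ℕ) * ∫ u₂ in Ioi ((((g * g * (k₁ * k₂) : ℕ) : ℝ) / qhat q ^ (2 : ℕ)) / u₁), Real.exp (-(u₁ + u₂)) / (1 - Real.exp (-(u₁ + u₂))) ^ (2 : ℕ) * Real.log u₂ ^ (2 : ℕ)) - (Real.log (qhat q ^ (2 : ℕ) / ((g * g * (k₁ * k₂) : ℕ) : ℝ)) ^ (7 : ℕ) / 896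 - μ₂ / 40 * Real.log (qhat q ^ (2 : ℕ) / ((g * g * (k₁ * k₂) : ℕ) : ℝ)) ^ (5 : ℕ) - μ₄ / 6 * Real.log (qhat q ^ (2 : ℕ) / ((g * g * (k₁ * k₂) : ℕ) : ℝ)) ^ (3 : ℕ) + 2 * μ₆ * Real.log (qhat q ^ (2 : ℕ) / ((g * g * (k₁ * k₂) : ℕ) : ℝ)) + E₄₂)) +
              2 * (2 * (Real.log (qhat q) - Real.log g) - Real.log k₁ - Real.log k₂) * ((∫ u₁ in Ioi (0 : ℝ), Real.log u₁ ^ (4 : ℕ) * ∫ u₂ in Ioi ((((g * g * (k₁ * k₂) : ℕ) : ℝ) / qhat q ^ (2 : ℕ)) / u₁), Real.exp (-(u₁ + u₂)) / (1 - Real.exp (-(u₁ + u₂))) ^ (2 : ℕ) * Real.log u₂ ^ (3 : ℕ)) - (-(Real.log (qhat q ^ (2 : ℕ) / ((g * g * (k₁ * k₂) : ℕ) : ℝ)) ^ (8 : ℕ)) / 2048 + μ₂ / 32 * Real.log (qhat q ^ (2 : ℕ) / ((g * g * (k₁ * k₂) : ℕ) : ℝ)) ^ (6 : ℕ) - 3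 * μ₄ / 16 * Real.log (qhat q ^ (2 : ℕ) / ((g * g * (k₁ * k₂) : ℕ) : ℝ)) ^ (4 : ℕ) + μ₆ / 2 * Real.log (qhat q ^ (2 : ℕ) / ((g * g * (k₁ * k₂) : ℕ) : ℝ)) ^ (2 : ℕ) + E₄₃)) +
               ((∫ u₁ in Ioi (0 : ℝ), Real.log u₁ ^ (4 : ℕ) * ∫ u₂ in Ioi ((((g * g * (k₁ * k₂) : ℕ) : ℝ) / qhat q ^ (2 : ℕ)) / u₁), Real.exp (-(u₁ + u₂)) / (1 - Real.exp (-(u₁ + u₂))) ^ (2 : ℕ) * Real.log u₂ ^ (4 : ℕ)) - (Real.log (qhat q ^ (2 : ℕ) / ((g * g * (k₁ * k₂) : ℕ) : ℝ)) ^ (9 : ℕ) / 4608 - μ₂ / 56 * Real.log (qhat q ^ (2 : ℕ) / ((g * g * (k₁ * k₂) : ℕ) : ℝ)) ^ (7 : ℕ) + 3 * μ₄ / 20 * Real.log (qhat q ^ (2 : ℕ) / ((g * g * (k₁ * k₂) : ℕ) : ℝ)) ^ (5 : ℕ) - 2 * μ₆ / 3 * Real.log (qhat q ^ (2 : ℕ)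 / ((g * g * (k₁ * k₂) : ℕ) : ℝ)) ^ (3 : ℕ) + 2 * μ₈ * Real.log (qhat q ^ (2 : ℕ) / ((g * g * (k₁ * k₂) : ℕ) : ℝ)) + E₄₄))))| ≤
          C * Real.log (qhat q) ^ (5 : ℕ) := by
  obtain ⟨E₀₀, E₀₁, E₀₂, E₀₃, E₀₄, E₁₀, E₁₁, E₁₂, E₁₃, E₁₄, E₂₀, E₂₁, E₂₂, E₂₃, E₂₄, E₃₀, E₃₁, E₃₂, E₃₃, E₃₄, E₄₀, E₄₁, E₄₂, E₄₃, E₄₄, μ₂, μ₄, μ₆, μ₈, hin⟩ :=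
    abs_inner_rem_selberg_le₄₄
  refine ⟨E₀₀, E₀₁, E₀₂, E₀₃, E₀₄, E₁₀, E₁₁, E₁₂, E₁₃, E₁₄, E₂₀, E₂₁, E₂₂, E₂₃, E₂₄, E₃₀, E₃₁, E₃₂, E₃₃, E₃₄, E₄₀, E₄₁, E₄₂, E₄₃, E₄₄, μ₂, μ₄, μ₆, μ₈,
    fun P hP Δ' h1 h32 ↦ ?_⟩
  obtain ⟨hP0, -⟩ := coeff_zero_one_of_admissible hP
  obtain ⟨Cin, hCin, hI⟩ := hin P hP0
  obtain ⟨C₈, hC₈, hC₈b⟩ := rpow_neg_le_div_log_pow (show (0 : ℝ) < 1 / 8 by norm_num) 23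
  set Z₂ : ℝ := (∑' d : ℕ, (d : ℝ) ^ (-(5 / 4 : ℝ))) ^ 2 with hZ₂
  have hZ₂0 : 0 ≤ Z₂ := sq_nonneg _
  obtain ⟨q₃, hq₃⟩ := exists_log_qhat_ge (2 : ℝ)
  refine ⟨Cin * (Z₂ ^ 2 * (16 * 5 ^ (20 + 2) * C₈ + 6 * 4 ^ 16 * 5 ^ (20 + 1))), q₃, fun q _ hq ↦ ?_⟩
  -- the level
  have hl2 : (2 : ℝ) ≤ Real.log (qhat q) := hq₃ q hq
  set Q : ℝ := qhat q with hQdef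
  have hQ0' : 0 ≤ Q := by rw [hQdef]; unfold qhat; positivity
  have hQ : 0 < Q := lt_of_le_of_ne hQ0' fun h0 ↦ by rw [← h0, Real.log_zero] at hl2; linarith
  have hQ3 : 3 ≤ Q := by
    have := Real.add_one_le_exp (Real.log Q)
    rw [Real.exp_log hQ] at this
    linarith
  have hQ1 : 1 ≤ Q := by linarith
  have hQ2 : 2 ≤ Q := by linarith
  set LQ : ℝ := Real.log Q with hLQdef
  have hLQ1 : 1 ≤ LQ := by linarith
  -- the mollifier length
  set M : ℝ := Q ^ Δ' with hMdef
  have hMQ : Q ≤ M := by rw [hMdef]; exact Real.self_le_rpow_of_one_le hQ1 h1.le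
  have hM2 : 2 ≤ M := by linarith
  have hM1 : 1 ≤ M := by linarith
  have hM0 : 0 < M := by linarith
  have hM32 : M ≤ Q ^ (3 / 2 : ℝ) := Real.rpow_le_rpow_of_exponent_le hQ1 h32
  have hlogM : Real.log M = Δ' * LQ := by rw [hMdef, hLQdef]; exact Real.log_rpow hQ Δ'
  have hlogM0 : 0 ≤ Real.log M := Real.log_nonneg hM1
  set Lam : ℝ := 1 + 2 * Real.log M + Real.log Q with hLamdef
  have hLam1 : 1 ≤ Lam := by rw [hLamdef]; linarith
  have hLam5 : Lam ≤ 5 * LQ := by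
    rw [hLamdef, hlogM]
    have : Δ' * LQ ≤ 3 / 2 * LQ := mul_le_mul_of_nonneg_right h32 (by linarith)
    rw [← hLQdef]; linarith
  set N : ℕ := ⌊M⌋₊ with hNdef
  have hN1 : 1 ≤ N := Nat.le_floor (by simpa using hM1)
  have hNM : (N : ℝ) ≤ M := Nat.floor_le hM0.le
  have hN0 : (0 : ℝ) < N := by exact_mod_cast hN1
  have hlogN0 : 0 ≤ Real.log (N : ℝ) := Real.log_nonneg (by exact_mod_cast hN1)
  have hlogN : Real.log (N : ℝ) ≤ Real.log M := Real.log_le_log hN0 hNM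
  have h1lN : 1 + Real.log (N : ℝ) ≤ Lam := by
    rw [hLamdef]; have : 0 ≤ Real.log Q := by rw [← hLQdef]; linarith
    linarith
  have h2lN : 2 + Real.log (N : ℝ) ≤ 2 * Lam := by linarith
  have hLam20 : 0 ≤ Lam ^ 20 := by positivity
  -- the threshold `K₁ = ⌊Q^{1/4}⌋`
  obtain ⟨hK1, hKQ, hKlog⟩ := floor_rpow_facts hQ1 (show (0 : ℝ) < 1 / 4 by norm_num)
  set K₁ : ℕ := ⌊Q ^ (1 / 4 : ℝ)⌋₊ with hK₁def
  have hK0 : (0 : ℝ) ≤ K₁ := Nat.cast_nonneg _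
  have hlogK0 : 0 ≤ Real.log (K₁ : ℝ) := Real.log_natCast_nonneg K₁
  -- the power savings `A₁ ≤ 4C₈/(1+LQ)²³`
  have hKM : (K₁ : ℝ) * M ≤ Q ^ (1 / 4 : ℝ) * Q ^ (3 / 2 : ℝ) := mul_le_mul hKQ hM32 hM0.le (by positivity)
  have hQ8 : Q ^ (-(1 / 8 : ℝ)) ≤ C₈ / (1 + LQ) ^ (20 + 3) := hC₈b Q hQ1
  have hQ80 : 0 ≤ Q ^ (-(1 / 8 : ℝ)) := by positivity
  have hb1 : Real.sqrt (2 * K₁ * M) / Q ≤ Real.sqrt 2 * Q ^ (-(1 / 8 : ℝ)) := by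
    have hsq : (Q ^ (7 / 8 : ℝ)) ^ 2 = Q ^ (1 / 4 : ℝ) * Q ^ (3 / 2 : ℝ) := by
      rw [← Real.rpow_natCast, ← Real.rpow_mul hQ.le, ← Real.rpow_add hQ]
      congr 1; norm_num
    have h1' : 2 * (K₁ : ℝ) * M ≤ 2 * (Q ^ (7 / 8 : ℝ)) ^ 2 := by rw [hsq]; linarith
    have h2' : Real.sqrt (2 * K₁ * M) ≤ Real.sqrt 2 * Q ^ (7 / 8 : ℝ) := by
      calc Real.sqrt (2 * K₁ * M) ≤ Real.sqrt (2 * (Q ^ (7 / 8 : ℝ)) ^ 2) := Real.sqrt_le_sqrt h1'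
        _ = Real.sqrt 2 * Q ^ (7 / 8 : ℝ) := by rw [Real.sqrt_mul (by norm_num), Real.sqrt_sq (by positivity)]
    rw [div_le_iff₀ hQ]
    refine h2'.trans (le_of_eq ?_)
    rw [mul_assoc, ← Real.rpow_add_one hQ.ne']
    congr 1; norm_num
  have hb2 : 2 * K₁ * M / Q ^ 2 ≤ 2 * Q ^ (-(1 / 8 : ℝ)) := by
    have h74 : Q ^ (1 / 4 : ℝ) * Q ^ (3 / 2 : ℝ) = Q ^ (-(1 / 4) : ℝ) * Q ^ 2 := by
      rw [← Real.rpow_add hQ, show (1 / 4 : ℝ) + 3 / 2 = -(1 / 4) + 2 by norm_num, Real.rpow_add hQ, Real.rpow_two]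
    have hKM' : (K₁ : ℝ) * M ≤ Q ^ (-(1 / 4) : ℝ) * Q ^ 2 := h74 ▸ hKM
    have h48 : Q ^ (-(1 / 4) : ℝ) ≤ Q ^ (-(1 / 8 : ℝ)) := Real.rpow_le_rpow_of_exponent_le hQ1 (by norm_num)
    rw [div_le_iff₀ (by positivity)]
    nlinarith [sq_nonneg Q]
  have hs2 : Real.sqrt 2 ≤ 2 := by
    have := Real.sq_sqrt (show (0 : ℝ) ≤ 2 by norm_num)
    nlinarith [Real.sqrt_nonneg 2]
  have hA₁0 : 0 ≤ Real.sqrt (2 * K₁ * M) / Q + 2 * K₁ * M / Q ^ 2 := by positivity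
  have hA₁ : Real.sqrt (2 * K₁ * M) / Q + 2 * K₁ * M / Q ^ 2 ≤ 4 * C₈ / (1 + LQ) ^ (20 + 3) := by
    calc _ ≤ Real.sqrt 2 * Q ^ (-(1 / 8 : ℝ)) + 2 * Q ^ (-(1 / 8 : ℝ)) := add_le_add hb1 hb2
      _ ≤ 2 * Q ^ (-(1 / 8 : ℝ)) + 2 * Q ^ (-(1 / 8 : ℝ)) := by gcongr
      _ = 4 * Q ^ (-(1 / 8 : ℝ)) := by ring
      _ ≤ 4 * (C₈ / (1 + LQ) ^ (20 + 3)) := by gcongr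
      _ = 4 * C₈ / (1 + LQ) ^ (20 + 3) := by ring
  -- the log saving `A₂ ≤ 4¹⁶/LQ¹⁶`
  have hA₂0 : 0 ≤ 1 / (1 + Real.log (K₁ : ℝ)) ^ 16 := by positivity
  have hA₂ : 1 / (1 + Real.log (K₁ : ℝ)) ^ 16 ≤ 4 ^ 16 / LQ ^ 16 := by
    have hx : LQ ≤ 4 * (1 + Real.log (K₁ : ℝ)) := by rw [hLQdef]; linarith
    have hx12 : LQ ^ 16 ≤ (4 * (1 + Real.log (K₁ : ℝ))) ^ 16 := pow_le_pow_left₀ (by linarith) hx 16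
    rw [div_le_div_iff₀ (by positivity) (by positivity), one_mul, mul_pow] at *
    linarith
  -- the per-term input
  have hF := fun (n g : ℕ) (hn : n ≠ 0) (hg : g ≠ 0) (hnM : (n : ℝ) ≤ M) (hgM : (g : ℝ) ≤ M) (K : ℕ)
      (hK : 2 * ((g : ℝ) ^ 2 / Q ^ 2) * K * (M / n) ≤ 1) ↦ hI n g hn hg Q M hQ2 hM2 hnM hgM K hK
  -- rewrite the inner sums (`τ ↦ a_n`, generic weight) and bound termwise
  rw [Finset.sum_congr rfl fun c hc ↦ Finset.sum_congr rfl fun g hg ↦ by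
    rw [selbergRem_inner_eq_weight P hM0 (n := c * g)
      (mul_ne_zero (by have := (Finset.mem_Icc.1 hc).1; omega) (by have := (Finset.mem_Icc.1 hg).1; omega))]]
  have hterm := fun c (hc : c ∈ Icc 1 N) g (hg : g ∈ Icc 1 (N / c)) ↦
    per_term_bound_gen_pow 16 (w := fun n ↦ divWeight n ^ 2) (E := Lam ^ 20) hCin.le hLam20 (fun n ↦ sq_nonneg _) hQ hM1
      hF K₁ hc hg
  calc _ ≤ ∑ c ∈ Icc 1 N, ∑ g ∈ Icc 1 (N / c),
        Cin * Lam ^ 20 * (divWeight (c * g) ^ 2 / ((c : ℝ) * g) * (Real.sqrt (2 * K₁ * M) / Q + 2 * K₁ * M / Q ^ 2) +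
          divWeight (c * g) ^ 2 / ((c : ℝ) * g ^ 2) * (1 / (1 + Real.log K₁) ^ 16)) := by
        refine (Finset.abs_sum_le_sum_abs _ _).trans (Finset.sum_le_sum fun c hc ↦ ?_)
        exact (Finset.abs_sum_le_sum_abs _ _).trans (Finset.sum_le_sum fun g hg ↦ hterm c hc g hg)
    _ = Cin * Lam ^ 20 * ((∑ c ∈ Icc 1 N, ∑ g ∈ Icc 1 (N / c), divWeight (c * g) ^ 2 / ((c : ℝ) * g)) *
            (Real.sqrt (2 * K₁ * M) / Q + 2 * K₁ * M / Q ^ 2) +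
          (∑ c ∈ Icc 1 N, ∑ g ∈ Icc 1 (N / c), divWeight (c * g) ^ 2 / ((c : ℝ) * g ^ 2)) *
            (1 / (1 + Real.log K₁) ^ 16)) := by
        rw [Finset.sum_mul, Finset.sum_mul, ← Finset.sum_add_distrib, Finset.mul_sum]
        refine Finset.sum_congr rfl fun c _ ↦ ?_
        rw [Finset.sum_mul, Finset.sum_mul, ← Finset.sum_add_distrib, Finset.mul_sum]
    _ ≤ Cin * Lam ^ 20 * ((Z₂ * (2 + Real.log N)) ^ 2 * (Real.sqrt (2 * K₁ * M) / Q + 2 * K₁ * M / Q ^ 2) +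
          3 * Z₂ ^ 2 * (2 + Real.log N) * (1 / (1 + Real.log K₁) ^ 16)) := by
        have hCL : 0 ≤ Cin * Lam ^ 20 := by positivity
        apply mul_le_mul_of_nonneg_left _ hCL
        exact add_le_add (mul_le_mul_of_nonneg_right (sum_sum_divWeightSq_div_mul_le hN1) hA₁0)
          (mul_le_mul_of_nonneg_right (sum_sum_divWeightSq_div_mul_sq_le hN1) hA₂0)
    _ ≤ Cin * (Z₂ ^ 2 * (16 * 5 ^ (20 + 2) * C₈ + 6 * 4 ^ 16 * 5 ^ (20 + 1))) * LQ ^ 5 :=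
        final_arith_pow (e := 20) (A := 16) (b := 5) rfl hCin.le hC₈.le hLQ1 hLam1 hLam5 hlogN0 h2lN hA₁0 hA₁ hA₂0 hA₂

end Summit.Parity.GeneralizedHardyLittlewood.Theorems.MomentsBeyondDiagonal.DiagCorner

end
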